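import Summits.CriticalPhenomena.Ising3DConformalLimit.Theorems.HarmonicMomentsIsotropyDilutionTransferNuB2
import Literature.Probability.LatticeModels.RegularScales

/-!
# The scaled subcritical two-point measures charge thin shells near the origin — inputs
(route HarmonicMomentsIsotropy, support item stmt-CriticalPhenomena-6036 `TwoPointAsymptoticIsotropy`;
helpers of `twoPointAsymptoticIsotropy_of_harmonicDilution_window`, file `…OfWindow`)

For `ν_β = χ⁻¹ ∑ₓ G_β(x) δ_{x/ξ₂}` (`G_β = ⟨σ₀σₓ⟩^f_β`, `0 < β < β_c`, `ξ₂² = M₂/χ`):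
* `integral_norm_sq_nu` — `∫ ‖y‖² dν_β = 1` (definition of `ξ₂`);
* `integral_norm_pow_four_nu_le` — under CLW (ii), `∫ ‖y‖⁴ dν_β ≤ K₄` uniformly (`nu_exp_moment`);
* `nu_annulus_ge` — hence the annulus `{1/2 < ‖y‖ ≤ A}` has mass `≥ 1/(2A²)` (`A² ≥ 4K₄`), from
  `‖y‖² ≤ 1/4 + A² 1{1/2 < ‖y‖ ≤ A} + ‖y‖⁴/A²`;
* `nu_annulus_le_axisValue`, `axisValue_le_nu_shell` — Messager–Miracle-Solé for the free state
  (tree: `twoPointFree_le_single_of_le`, `twoPointFree_single_le_of_mul_le`): with `n₀ = ⌈3ρ₂ξ₂⌉`,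
  `G_β ≤ G_β(n₀e₁)` on the annulus (which lies in `Λ_{⌊Aξ₂⌋}`) and `G_β ≥ G_β(n₀e₁)` on the shell
  `{ρ₁ξ₂ ≤ |x| ≤ ρ₂ξ₂}` (`ρ₂ ≤ 1/36`), which contains a lattice cube of radius `⌊(ρ₂-ρ₁)ξ₂/8⌋`.

References: A. Messager, S. Miracle-Solé, J. Stat. Phys. 17 (1977) 245 [MessagerMiracleSoleJSP1977];
G. C. Hegerfeldt, Comm. Math. Phys. 57 (1977) 259 [Hegerfeldt1977].  No definitions, no named facts;
axioms standard.
-/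

noncomputable section

open MeasureTheory Filter Topology Set
open scoped ENNReal NNReal BigOperators
open Literature.Probability.LatticeModels

namespace Summit.CriticalPhenomena.Ising3DConformalLimit.Theorems.HarmonicMomentsIsotropy

open scoped Classical

/-! ## Moments of `ν_β` -/

/-- **`∫ ‖y‖² dν_β = 1`**: the second moment of the scaled measure is one by the definition of
`ξ₂² = M₂/χ`. -/
theorem integral_norm_sq_nu {β : ℝ} (hβ : 0 < β) (hβc : β < criticalBeta 3) :
    ∫ y, ‖y‖ ^ 2 ∂(nu β) = 1 := by
  have hχ := chi_pos hβ.le hβc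
  have hξ := xi_pos hβ hβc
  have hM := msq_pos hβ hβc
  have hmeas : Measurable fun y : V => ‖y‖ ^ 2 := continuous_norm.measurable.pow_const 2
  rw [integral_nu hβ.le hβc hmeas (A := 1) (B := 0) (q := 2)
    (fun y => by rw [abs_of_nonneg (by positivity)]; linarith)]
  have h1 : ∀ x : Site 3, twoPointFree 3 β x * ‖(xi β)⁻¹ • siteV x‖ ^ 2 =
      (xi β)⁻¹ ^ 2 * ((∑ i, ((x i : ℤ) : ℝ) ^ 2) * twoPointFree 3 β x) := fun x => by
    rw [norm_smul, Real.norm_eq_abs, abs_of_pos (inv_pos.2 hξ), mul_pow, norm_siteV_sq]; ring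
  simp_rw [h1]
  rw [tsum_mul_left]
  change (chi β)⁻¹ * ((xi β)⁻¹ ^ 2 * msq β) = 1
  rw [inv_pow, xi_sq hβ.le hβc]
  field_simp

/-- **Uniform fourth moment**: under CLW (ii), `∫ ‖y‖⁴ dν_β ≤ K₄` for `β` in the window
(`‖y‖⁴ ≤ 4!(2/c₀)⁴ e^{(c₀/2)‖y‖}` and `nu_exp_moment`). -/
theorem integral_norm_pow_four_nu_le {c₀ C β₀ : ℝ} (hc₀ : 0 < c₀)
    (hii : ∀ β : ℝ, β₀ ≤ β → β < criticalBeta 3 → ∀ A : ℝ, 1 ≤ A →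
      (∑' x : Site 3, if A ^ 2 * msq β < (∑ i, ((x i : ℤ) : ℝ) ^ 2) * chi β
        then twoPointFree 3 β x else 0) ≤ C * Real.exp (-(c₀ * A)) * chi β) :
    ∃ K₄ : ℝ, 0 < K₄ ∧ ∀ β : ℝ, β₀ ≤ β → 0 < β → β < criticalBeta 3 →
      Integrable (fun y : V => ‖y‖ ^ 4) (nu β) ∧ ∫ y, ‖y‖ ^ 4 ∂(nu β) ≤ K₄ := by
  obtain ⟨K, hK⟩ := nu_exp_moment hc₀ hii
  refine ⟨max ((Nat.factorial 4 : ℝ) * (2 / c₀) ^ 4 * K) 1, by positivity, fun β h1 h2 h3 => ?_⟩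
  obtain ⟨hint, hle⟩ := hK β h1 h2 h3
  have hpt : ∀ y : V, ‖y‖ ^ 4 ≤ (Nat.factorial 4 : ℝ) * (2 / c₀) ^ 4 * Real.exp (c₀ / 2 * ‖y‖) :=
    fun y => IsingInputs.pow_le_factorial_mul_exp hc₀ 4 (norm_nonneg y)
  have hint4 : Integrable (fun y : V => ‖y‖ ^ 4) (nu β) := by
    refine (hint.const_mul ((Nat.factorial 4 : ℝ) * (2 / c₀) ^ 4)).mono'
      (continuous_norm.measurable.pow_const 4).aestronglyMeasurable (ae_of_all _ fun y => ?_)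
    rw [Real.norm_eq_abs, abs_of_nonneg (by positivity)]
    exact hpt y
  refine ⟨hint4, le_trans ?_ (le_max_left _ _)⟩
  calc ∫ y, ‖y‖ ^ 4 ∂(nu β) ≤ ∫ y, (Nat.factorial 4 : ℝ) * (2 / c₀) ^ 4 * Real.exp (c₀ / 2 * ‖y‖)
        ∂(nu β) := integral_mono hint4 (hint.const_mul _) hpt
    _ = (Nat.factorial 4 : ℝ) * (2 / c₀) ^ 4 * ∫ y, Real.exp (c₀ / 2 * ‖y‖) ∂(nu β) :=
        integral_const_mul _ _
    _ ≤ (Nat.factorial 4 : ℝ) * (2 / c₀) ^ 4 * K := mul_le_mul_of_nonneg_left hle (by positivity)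

/-- **The unit annulus is charged**: under CLW (ii) there is `A ≥ 1` with
`ν_β{1/2 < ‖y‖ ≤ A} ≥ 1/(2A²)` for all `β` in the window (second moment one, fourth moment bounded,
and `‖y‖² ≤ 1/4 + A² 1{1/2 < ‖y‖ ≤ A} + ‖y‖⁴/A²`). -/
theorem nu_annulus_ge {c₀ C β₀ : ℝ} (hc₀ : 0 < c₀)
    (hii : ∀ β : ℝ, β₀ ≤ β → β < criticalBeta 3 → ∀ A : ℝ, 1 ≤ A →
      (∑' x : Site 3, if A ^ 2 * msq β < (∑ i, ((x i : ℤ) : ℝ) ^ 2) * chi β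
        then twoPointFree 3 β x else 0) ≤ C * Real.exp (-(c₀ * A)) * chi β) :
    ∃ A : ℝ, 1 ≤ A ∧ ∀ β : ℝ, β₀ ≤ β → 0 < β → β < criticalBeta 3 →
      1 / (2 * A ^ 2) ≤ ((nu β) {y : V | 1 / 2 < ‖y‖ ∧ ‖y‖ ≤ A}).toReal := by
  obtain ⟨K₄, hK₄, hK⟩ := integral_norm_pow_four_nu_le hc₀ hii
  set A : ℝ := 2 * Real.sqrt K₄ + 1 with hA
  have hsK : 0 ≤ Real.sqrt K₄ := Real.sqrt_nonneg _
  have hA1 : 1 ≤ A := by rw [hA]; linarith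
  have hApos : 0 < A := by linarith
  have hA2 : 4 * K₄ ≤ A ^ 2 := by
    rw [hA]; nlinarith [Real.sq_sqrt hK₄.le]
  refine ⟨A, hA1, fun β h1 h2 h3 => ?_⟩
  obtain ⟨hint4, hle4⟩ := hK β h1 h2 h3
  haveI : IsProbabilityMeasure (nu β) := isProbabilityMeasure_nu h2.le h3
  set S : Set V := {y : V | 1 / 2 < ‖y‖ ∧ ‖y‖ ≤ A} with hS
  have hSm : MeasurableSet S :=
    (isOpen_lt continuous_const continuous_norm).measurableSet.inter
      (isClosed_le continuous_norm continuous_const).measurableSet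
  -- the pointwise bound
  have hpt : ∀ y : V, ‖y‖ ^ 2 ≤ 1 / 4 + A ^ 2 * S.indicator 1 y + ‖y‖ ^ 4 / A ^ 2 := by
    intro y
    have h4 : 0 ≤ ‖y‖ ^ 4 / A ^ 2 := by positivity
    have hind0 : 0 ≤ A ^ 2 * S.indicator 1 y := by
      refine mul_nonneg (sq_nonneg _) (Set.indicator_nonneg (fun _ _ => zero_le_one) _)
    by_cases hy1 : ‖y‖ ≤ 1 / 2
    · have : ‖y‖ ^ 2 ≤ (1 / 2) ^ 2 := pow_le_pow_left₀ (norm_nonneg _) hy1 2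
      linarith
    by_cases hy2 : ‖y‖ ≤ A
    · have hyS : y ∈ S := ⟨lt_of_not_ge hy1, hy2⟩
      rw [Set.indicator_of_mem hyS, Pi.one_apply, mul_one]
      have : ‖y‖ ^ 2 ≤ A ^ 2 := pow_le_pow_left₀ (norm_nonneg _) hy2 2
      linarith
    · have hyA : A < ‖y‖ := lt_of_not_ge hy2
      have : ‖y‖ ^ 2 ≤ ‖y‖ ^ 4 / A ^ 2 := by
        rw [le_div_iff₀ (by positivity)]
        have : A ^ 2 ≤ ‖y‖ ^ 2 := pow_le_pow_left₀ hApos.le hyA.le 2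
        nlinarith [sq_nonneg ‖y‖]
      linarith
  -- integrate
  have hint2 : Integrable (fun y : V => ‖y‖ ^ 2) (nu β) :=
    integrable_nu h2.le h3 (continuous_norm.measurable.pow_const 2) (A := 1) (B := 0) (q := 2)
      (fun y => by rw [abs_of_nonneg (by positivity)]; linarith)
  have hindint : Integrable (fun y : V => A ^ 2 * S.indicator 1 y) (nu β) :=
    ((integrable_const (1 : ℝ)).indicator hSm).const_mul _
  have hrhs : Integrable (fun y : V => 1 / 4 + A ^ 2 * S.indicator 1 y + ‖y‖ ^ 4 / A ^ 2) (nu β) :=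
    ((integrable_const _).add hindint).add (hint4.div_const _)
  have hI := integral_mono hint2 hrhs hpt
  have i1 : Integrable (fun _ : V => (1 / 4 : ℝ)) (nu β) := integrable_const _
  have i3 : Integrable (fun y : V => ‖y‖ ^ 4 / A ^ 2) (nu β) := hint4.div_const _
  have i12 : Integrable (fun y : V => 1 / 4 + A ^ 2 * S.indicator 1 y) (nu β) := i1.add hindint
  have e1 : ∫ y, (1 / 4 + A ^ 2 * S.indicator 1 y + ‖y‖ ^ 4 / A ^ 2) ∂(nu β) =
      (∫ y, (1 / 4 + A ^ 2 * S.indicator 1 y) ∂(nu β)) + ∫ y, ‖y‖ ^ 4 / A ^ 2 ∂(nu β) :=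
    integral_add i12 i3
  have e2 : ∫ y, (1 / 4 + A ^ 2 * S.indicator 1 y) ∂(nu β) =
      (∫ _, (1 / 4 : ℝ) ∂(nu β)) + ∫ y, A ^ 2 * S.indicator 1 y ∂(nu β) := integral_add i1 hindint
  have e3 : ∫ _, (1 / 4 : ℝ) ∂(nu β) = 1 / 4 := by
    rw [integral_const, probReal_univ, one_smul]
  have e4 : ∫ y, A ^ 2 * S.indicator 1 y ∂(nu β) = A ^ 2 * ((nu β) S).toReal := by
    rw [integral_const_mul, integral_indicator_one hSm]; rfl
  have e5 : ∫ y, ‖y‖ ^ 4 / A ^ 2 ∂(nu β) = (∫ y, ‖y‖ ^ 4 ∂(nu β)) / A ^ 2 := integral_div _ _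
  rw [integral_norm_sq_nu h2 h3, e1, e2, e3, e4, e5] at hI
  have h4 : (∫ y, ‖y‖ ^ 4 ∂(nu β)) / A ^ 2 ≤ 1 / 4 := by
    rw [div_le_iff₀ (by positivity)]; linarith
  rw [div_le_iff₀ (by positivity)]
  nlinarith [ENNReal.toReal_nonneg (a := (nu β) S)]

/-! ## Small lattice lemmas -/

/-- `siteV` is additive. -/
theorem siteV_add (x y : Site 3) : siteV (x + y) = siteV x + siteV y := by
  ext i; simp [siteV, siteW]

/-- The Euclidean norm of the axis site `k e₁` is `|k|`. -/
theorem norm_siteV_single (h : 0 < 3) (k : ℤ) :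
    ‖siteV (Pi.single (⟨0, h⟩ : Fin 3) k)‖ = |(k : ℝ)| := by
  have h0 : (⟨0, h⟩ : Fin 3) = 0 := rfl
  rw [h0, norm_siteV, Fin.sum_univ_three]
  simp [Real.sqrt_sq_eq_abs]

/-- A cut-off constant sum over a box: `∑' x, 1{x ∈ Λ_N} m = (2N+1)³ m`. -/
theorem tsum_ite_mem_box_const (N : ℕ) (m : ℝ) :
    (∑' x : Site 3, if x ∈ box 3 N then m else 0) = (2 * (N : ℝ) + 1) ^ 3 * m := by
  rw [tsum_eq_sum (s := box 3 N) (fun x hx => if_neg hx), Finset.sum_ite_mem, Finset.inter_self,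
    Finset.sum_const, nsmul_eq_mul, card_box]
  push_cast; ring

/-! ## Messager–Miracle-Solé: thin shells near the origin are charged -/

/-- **Annulus step.** For `0 < β < β_c`, `ξ₂ ≥ 12` and `ρ₂ ≤ 1/36`: with `n₀ = ⌈3ρ₂ξ₂⌉`, every
lattice point `x` with `ξ₂/2 < |x| ≤ Aξ₂` has `G_β(x) ≤ G_β(n₀e₁)` (Messager–Miracle-Solé, axis
form: `‖x‖_∞ ≥ |x|/3 > ξ₂/6 ≥ n₀`) and lies in the box `Λ_{⌊Aξ₂⌋}`, so
`ν_β{1/2 < ‖y‖ ≤ A} ≤ χ⁻¹ (2⌊Aξ₂⌋+1)³ G_β(n₀e₁)`.  [cite: MessagerMiracleSoleJSP1977, main theorem (monotonicity of ⟨σ₀σ_x⟩ under reflections)] -/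
theorem nu_annulus_le_axisValue {β : ℝ} (hβ0 : 0 < β) (hβc : β < criticalBeta 3)
    {ρ₂ A : ℝ} (hρ₂0 : 0 ≤ ρ₂) (hρ₂ : ρ₂ ≤ 1 / 36) (hξ12 : 12 ≤ xi β) :
    ((nu β) {y : V | 1 / 2 < ‖y‖ ∧ ‖y‖ ≤ A}).toReal ≤
      (chi β)⁻¹ * ((2 * (⌊A * xi β⌋₊ : ℝ) + 1) ^ 3 *
        twoPointFree 3 β (Pi.single (⟨0, by norm_num⟩ : Fin 3) ((⌈3 * ρ₂ * xi β⌉₊ : ℕ) : ℤ))) := by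
  have hχ := chi_pos hβ0.le hβc
  have hξpos : 0 < xi β := xi_pos hβ0 hβc
  have h3 : (1 : ℕ) ≤ 3 := by norm_num
  set ξ : ℝ := xi β with hξdef
  set n₀ : ℕ := ⌈3 * ρ₂ * ξ⌉₊ with hn₀
  set m : ℝ := twoPointFree 3 β (Pi.single (⟨0, h3⟩ : Fin 3) (n₀ : ℤ)) with hm
  have hm0 : 0 ≤ m := IsingInputs.G_nonneg hβ0.le _
  have hn₀le : (n₀ : ℝ) ≤ 3 * ρ₂ * ξ + 1 := (Nat.ceil_lt_add_one (by positivity)).le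
  have hρξ : ρ₂ * ξ ≤ 1 / 36 * ξ := mul_le_mul_of_nonneg_right hρ₂ hξpos.le
  -- (1) on the annulus `G ≤ m`
  have hann_le : ∀ x : Site 3, (1 / 2 < ‖ξ⁻¹ • siteV x‖ ∧ ‖ξ⁻¹ • siteV x‖ ≤ A) →
      twoPointFree 3 β x ≤ m := by
    intro x hx
    refine twoPointFree_le_single_of_le hβ0.le h3 ?_
    have h1 := hx.1
    rw [norm_smul, Real.norm_eq_abs, abs_of_pos (inv_pos.2 hξpos), ← div_eq_inv_mul,
      lt_div_iff₀ hξpos] at h1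
    have h2 : ‖siteV x‖ ≤ 3 * (Site.supNorm x : ℝ) := by
      rw [← Site.norm_eq_supNorm]; exact norm_siteV_le x
    have h4 : (n₀ : ℝ) < Site.supNorm x := by linarith
    exact_mod_cast h4.le
  -- (2) the annulus lies in the box `Λ_N`, `N = ⌊Aξ⌋`
  set N : ℕ := ⌊A * ξ⌋₊ with hN
  have hann_box : ∀ x : Site 3, (1 / 2 < ‖ξ⁻¹ • siteV x‖ ∧ ‖ξ⁻¹ • siteV x‖ ≤ A) →
      x ∈ box 3 N := by
    intro x hx
    have h2 := hx.2
    rw [norm_smul, Real.norm_eq_abs, abs_of_pos (inv_pos.2 hξpos), ← div_eq_inv_mul,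
      div_le_iff₀ hξpos] at h2
    rw [mem_box_iff_supNorm_le, hN]
    refine Nat.le_floor ?_
    rw [← Site.norm_eq_supNorm]
    exact (norm_le_norm_siteV x).trans h2
  -- (3) the measure as a lattice sum
  rw [nu_apply_toReal hβ0.le hβc, ENNReal.toReal_ofReal]
  · refine mul_le_mul_of_nonneg_left ?_ (inv_nonneg.2 hχ.le)
    rw [← tsum_ite_mem_box_const]
    refine tsum_ite_le_tsum_ite hann_box (fun x => IsingInputs.G_nonneg hβ0.le x)
      (fun x hx => hann_le x hx) (fun _ => hm0) ?_
    exact summable_of_hasFiniteSupport ((box 3 N).finite_toSet.subset fun x hx => by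
      rw [Function.mem_support] at hx; by_contra h; exact hx (if_neg h))
  · exact mul_nonneg (inv_nonneg.2 hχ.le) (tsum_nonneg fun x => by
      split_ifs; exacts [IsingInputs.G_nonneg hβ0.le x, le_refl _])

/-- **Shell step.** For `0 < β < β_c`, `0 < ρ₁ < ρ₂` and `ξ₂ ≥ 8/(ρ₂-ρ₁)`: the Euclidean shell
`{ρ₁ξ₂ ≤ |x| ≤ ρ₂ξ₂}` contains the lattice cube of centre `⌊(ρ₁+ρ₂)ξ₂/2⌋ e₁` and radius
`M = ⌊(ρ₂-ρ₁)ξ₂/8⌋`, on which `G_β ≥ G_β(n₀ e₁)`, `n₀ = ⌈3ρ₂ξ₂⌉` (Messager–Miracle-Solé,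
diagonal-axis form: `3‖x‖_∞ ≤ 3|x| ≤ n₀`); hence `χ⁻¹ (2M+1)³ G_β(n₀e₁) ≤ ν_β{ρ₁ ≤ ‖y‖ ≤ ρ₂}`.
[cite: MessagerMiracleSoleJSP1977, main theorem (monotonicity of ⟨σ₀σ_x⟩ under reflections)] -/
theorem axisValue_le_nu_shell {β : ℝ} (hβ0 : 0 < β) (hβc : β < criticalBeta 3)
    {ρ₁ ρ₂ : ℝ} (hρ₁ : 0 < ρ₁) (hρ₁₂ : ρ₁ < ρ₂) (hξ8 : 8 ≤ (ρ₂ - ρ₁) * xi β) :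
    (chi β)⁻¹ * ((2 * (⌊(ρ₂ - ρ₁) * xi β / 8⌋₊ : ℝ) + 1) ^ 3 *
        twoPointFree 3 β (Pi.single (⟨0, by norm_num⟩ : Fin 3) ((⌈3 * ρ₂ * xi β⌉₊ : ℕ) : ℤ))) ≤
      ((nu β) {y : V | ρ₁ ≤ ‖y‖ ∧ ‖y‖ ≤ ρ₂}).toReal := by
  have hχ := chi_pos hβ0.le hβc
  have hξpos : 0 < xi β := xi_pos hβ0 hβc
  have hρ₂0 : 0 < ρ₂ := hρ₁.trans hρ₁₂
  have hd : 0 < ρ₂ - ρ₁ := by linarith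
  have h3 : (1 : ℕ) ≤ 3 := by norm_num
  set ξ : ℝ := xi β with hξdef
  set n₀ : ℕ := ⌈3 * ρ₂ * ξ⌉₊ with hn₀
  set m : ℝ := twoPointFree 3 β (Pi.single (⟨0, h3⟩ : Fin 3) (n₀ : ℤ)) with hm
  have hn₀ge : 3 * ρ₂ * ξ ≤ n₀ := Nat.le_ceil _
  -- the cube: centre `c e₁`, `c = ⌊ρ̄ξ⌋`, radius `M`
  set ρm : ℝ := (ρ₁ + ρ₂) / 2 with hρm
  have hρm0 : 0 < ρm := by rw [hρm]; positivity
  set c : ℕ := ⌊ρm * ξ⌋₊ with hc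
  set M : ℕ := ⌊(ρ₂ - ρ₁) * ξ / 8⌋₊ with hM
  have hcle : (c : ℝ) ≤ ρm * ξ := Nat.floor_le (by positivity)
  have hcge : ρm * ξ - 1 < c := by
    have := Nat.lt_floor_add_one (ρm * ξ); linarith
  have hMle : (M : ℝ) ≤ (ρ₂ - ρ₁) * ξ / 8 := Nat.floor_le (by positivity)
  have hρmξ : ρm * ξ = (ρ₁ * ξ + ρ₂ * ξ) / 2 := by rw [hρm]; ring
  set z : Site 3 := Pi.single (⟨0, h3⟩ : Fin 3) (c : ℤ) with hz
  have hnz : ‖siteV z‖ = c := by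
    rw [hz, norm_siteV_single]; push_cast; exact abs_of_nonneg (Nat.cast_nonneg _)
  set cube : Finset (Site 3) := (box 3 M).map (addLeftEmbedding z) with hcube
  have hcard : cube.card = (2 * M + 1) ^ 3 := by rw [hcube, Finset.card_map, card_box]
  have hmem : ∀ x ∈ cube, ∃ t ∈ box 3 M, x = z + t := fun x hx => by
    rw [hcube, Finset.mem_map] at hx
    obtain ⟨t, ht, rfl⟩ := hx
    exact ⟨t, ht, rfl⟩
  -- points of the cube: Euclidean radius in `[ρ₁ξ, ρ₂ξ]`
  have hrad : ∀ x ∈ cube, ρ₁ * ξ ≤ ‖siteV x‖ ∧ ‖siteV x‖ ≤ ρ₂ * ξ := by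
    intro x hx
    obtain ⟨t, ht, rfl⟩ := hmem x hx
    have htn : ‖siteV t‖ ≤ 3 * M := by
      refine (norm_siteV_le t).trans ?_
      rw [Site.norm_eq_supNorm]
      have := mem_box_iff_supNorm_le.1 ht
      exact_mod_cast Nat.mul_le_mul_left 3 this
    rw [siteV_add]
    have h1 : ‖siteV z‖ - ‖siteV t‖ ≤ ‖siteV z + siteV t‖ := by
      have := norm_sub_le (siteV z + siteV t) (siteV t)
      rw [add_sub_cancel_right] at this; linarith
    have h2 : ‖siteV z + siteV t‖ ≤ ‖siteV z‖ + ‖siteV t‖ := norm_add_le _ _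
    rw [hnz] at h1 h2
    constructor
    · linarith
    · linarith
  -- hence they satisfy the shell condition and `G ≥ m` there
  have hshellx : ∀ x ∈ cube, ρ₁ ≤ ‖ξ⁻¹ • siteV x‖ ∧ ‖ξ⁻¹ • siteV x‖ ≤ ρ₂ := by
    intro x hx
    obtain ⟨h1, h2⟩ := hrad x hx
    rw [norm_smul, Real.norm_eq_abs, abs_of_pos (inv_pos.2 hξpos), ← div_eq_inv_mul,
      le_div_iff₀ hξpos, div_le_iff₀ hξpos]
    exact ⟨h1, h2⟩
  have hGx : ∀ x ∈ cube, m ≤ twoPointFree 3 β x := by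
    intro x hx
    refine twoPointFree_single_le_of_mul_le hβ0.le h3 ?_
    have h2 := (hrad x hx).2
    have h5 : (Site.supNorm x : ℝ) ≤ ‖siteV x‖ := by
      rw [← Site.norm_eq_supNorm]; exact norm_le_norm_siteV x
    have h4 : (3 : ℝ) * Site.supNorm x ≤ n₀ := by linarith
    exact_mod_cast h4
  -- `ν(shell) ≥ χ⁻¹ (2M+1)³ m`
  rw [nu_apply_toReal hβ0.le hβc, ENNReal.toReal_ofReal]
  · refine mul_le_mul_of_nonneg_left ?_ (inv_nonneg.2 hχ.le)
    have hsum := summable_ite_G hβ0.le hβc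
      (fun x : Site 3 => ρ₁ ≤ ‖(xi β)⁻¹ • siteV x‖ ∧ ‖(xi β)⁻¹ • siteV x‖ ≤ ρ₂)
    calc (2 * (M : ℝ) + 1) ^ 3 * m = ∑ x ∈ cube, m := by
          rw [Finset.sum_const, hcard, nsmul_eq_mul]; push_cast; ring
      _ ≤ ∑ x ∈ cube, (if ρ₁ ≤ ‖(xi β)⁻¹ • siteV x‖ ∧ ‖(xi β)⁻¹ • siteV x‖ ≤ ρ₂
            then twoPointFree 3 β x else 0) :=
          Finset.sum_le_sum fun x hx => by rw [if_pos (hshellx x hx)]; exact hGx x hx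
      _ ≤ _ := hsum.sum_le_tsum cube fun x _ => by
          split_ifs; exacts [IsingInputs.G_nonneg hβ0.le x, le_refl _]
  · exact mul_nonneg (inv_nonneg.2 hχ.le) (tsum_nonneg fun x => by
      split_ifs; exacts [IsingInputs.G_nonneg hβ0.le x, le_refl _])

end Summit.CriticalPhenomena.Ising3DConformalLimit.Theorems.HarmonicMomentsIsotropy

end
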